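import Summits.ValiantsHypothesis.ValiantsHypothesis.Theorems.BarrierLeverPartitionMinorsHitByVPOfLowerSetsDoors

/-!
# Route BarrierLever — item `PartitionMinorsHitByVP` (stmt-ValiantsHypothesis-19717):
# the EXACT-COVER (brick product) door

Link file (`--supports stmt-ValiantsHypothesis-19717`; cell valiant-natproofs, rung V4, 𝒟-side door
(c); prover seat val-np-p1 gen 13). Definition-free. Closes NO item: it reduces item 19717 BY NAME to a
purely combinatorial statement about EXACT COVERS.

**The witness.** A BRICK is a pair `(Z | W)` of a set `Z` of `x`-indices and a set `W` of `y`-indices. For a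
list of `L` bricks with weights `ε`,
```
  f = ∏_{i < L} ( 1 + ε i · ∏_{a ∈ Z i} x_a · ∏_{c ∈ W i} y_c ),      x_a = X (Fin.castAdd h a), y_c = X (Fin.natAdd h c),
```
has size `≤ L (2h + 4)` (`complexity_brickProduct_le`); for `L ≤ (h+h)³` its truncation to degree `2h` lies in
`SmallCircuits ℂ (h+h) 8` (`h ≥ 2`). In the zeon algebra `f = exp(Σ_i ε_i x^{Z_i} y^{W_i})`, and the
coefficient of a square-free monomial `x^S y^T` in `f` is the weighted number of EXACT COVERS of `(S, T)`:
`Σ { ∏_{i∈I} ε_i : I ⊆ [L], (Z_i)_{i∈I} partition S, (W_i)_{i∈I} partition T }` (seat memo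
HOME/val-np-p1/g13/SEQUENTIAL-MEMO-valnp1-g13.md §7′; the door below is stated directly with
`MvPolynomial.coeff`, so this formula is documentation, not a dependency).

**Why (memo §7).** Brick products are exactly the monomial degenerations of every «exp-door» of the cell
(bi-additive, sequential, biclique): each vertex term `τ x_a e^{⟨φ,x⟩+⟨κ,y⟩}` of the sequential door
(`…SequentialDoor`, p554023) degenerates coefficientwise to one brick, so a nonsingular exact-cover matrix
on a layout is a CANCELLATION-FREE certificate that the layout is hit. Numerically (lab/bricks.py, randomised
construction, `≤ h` bricks per `y`-vertex): every labelled lower-set pair at `h ≤ 4` (2 591) and 1 620 / 1 620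
sampled at `h = 5` admit such a certificate (e.g. cube `2^[4]` versus the radius-2 Hamming ball in `[5]`:
14 bricks; star `K_{1,4}` versus `C₄`: 7; the killer `({∅,1,2,3},{∅,1′,2′,1′2′})`: `(1|1′),(2|2′),(3|1′2′)`).
EXACT-COVER CONJECTURE: every lower-set pair of equal size admits `≤ (h+h)³` bricks with nonsingular
exact-cover matrix — a purely combinatorial statement implying item 19717 by the theorem below.

**Results.**
* `complexity_brick_le`, `complexity_brickProduct_le` — sizes.
* `partitionMinor_hit_of_bricks` / `…_mem` — THE DOOR (explicit size; `SmallCircuits ℂ (h+h) 8` for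
  `h ≥ 2`, `L ≤ (h+h)³`).
* `partitionMinorsHitByVP_of_bricks` — arrow onto the route declaration (`b = 8`, `h₀ = 2`);
  `partitionMinorsHitByVP_of_bricks_lowerSets` — lower-set pairs suffice (`b = 12`).

WHAT THIS IS NOT: the exact-cover conjecture is OPEN (census above); nothing is claimed about it, about crux
stmt-ValiantsHypothesis-14610, or about `VP` versus `VNP`.
-/

set_option linter.dupNamespace false

namespace Summit.ValiantsHypothesis.ValiantsHypothesis.Theorems.BarrierLever.ExactCoverDoor

open Finset MvPolynomial
open Literature.Barriers.ValiantsHypothesis Literature.Computability.AlgebraicComplexity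
open Summit.ValiantsHypothesis.ValiantsHypothesis.Theorems.BarrierLever.AdditiveDoor
  (truncation_spec degree_partitionExpo_le)

noncomputable section

variable {h : ℕ}

/-! ## 1. Sizes -/

/-- A square-free monomial `∏_{v ∈ A} X (e v)` over `A ⊆ Fin h` has size `≤ h`. -/
theorem complexity_monomial_le (A : Finset (Fin h)) (e : Fin h → Fin (h + h)) :
    complexity (∏ v ∈ A, X (e v) : MvPolynomial (Fin (h + h)) ℂ) ≤ h := by
  calc _ ≤ ∑ v ∈ A, complexity (X (e v) : MvPolynomial (Fin (h + h)) ℂ) + A.card :=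
        complexity_finset_prod_le _ _
    _ = 0 + A.card := by rw [Finset.sum_eq_zero (fun v _ => complexity_X_holds _)]
    _ ≤ h := by rw [zero_add]; exact (Finset.card_le_univ A).trans_eq (Fintype.card_fin h)

/-- One brick factor `1 + C e · x^Z · y^W` has size `≤ 2h + 3`. -/
theorem complexity_brick_le (e : ℂ) (Z W : Finset (Fin h)) :
    complexity (1 + C e * (∏ a ∈ Z, X (Fin.castAdd h a)) * (∏ c ∈ W, X (Fin.natAdd h c)) :
      MvPolynomial (Fin (h + h)) ℂ) ≤ 2 * h + 3 := by
  calc _ ≤ complexity (1 : MvPolynomial (Fin (h + h)) ℂ) +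
        complexity (C e * (∏ a ∈ Z, X (Fin.castAdd h a)) * (∏ c ∈ W, X (Fin.natAdd h c)) :
          MvPolynomial (Fin (h + h)) ℂ) + 1 := complexity_add_le_holds _ _
    _ ≤ 0 + ((complexity (C e : MvPolynomial (Fin (h + h)) ℂ) +
          complexity (∏ a ∈ Z, X (Fin.castAdd h a) : MvPolynomial (Fin (h + h)) ℂ) + 1) +
          complexity (∏ c ∈ W, X (Fin.natAdd h c) : MvPolynomial (Fin (h + h)) ℂ) + 1) + 1 := by
        gcongr
        · rw [← C_1, complexity_C_holds]
        · exact (complexity_mul_le_holds _ _).trans (by gcongr; exact complexity_mul_le_holds _ _)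
    _ ≤ 0 + ((0 + h + 1) + h + 1) + 1 := by
        gcongr
        · exact (complexity_C_holds _).le
        · exact complexity_monomial_le _ _
        · exact complexity_monomial_le _ _
    _ = 2 * h + 3 := by ring

/-- **Size of a brick product** with `L` bricks: `≤ L (2h + 4)`. -/
theorem complexity_brickProduct_le {L : ℕ} (ε : Fin L → ℂ) (Z W : Fin L → Finset (Fin h)) :
    complexity (∏ i : Fin L, (1 + C (ε i) * (∏ a ∈ Z i, X (Fin.castAdd h a)) *
        (∏ c ∈ W i, X (Fin.natAdd h c))) : MvPolynomial (Fin (h + h)) ℂ) ≤ L * (2 * h + 4) := by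
  calc _ ≤ ∑ i : Fin L, complexity (1 + C (ε i) * (∏ a ∈ Z i, X (Fin.castAdd h a)) *
          (∏ c ∈ W i, X (Fin.natAdd h c)) : MvPolynomial (Fin (h + h)) ℂ) +
        (Finset.univ : Finset (Fin L)).card := complexity_finset_prod_le _ _
    _ ≤ ∑ _i : Fin L, (2 * h + 3) + (Finset.univ : Finset (Fin L)).card := by
        gcongr with i _; exact complexity_brick_le _ _ _
    _ = L * (2 * h + 4) := by simp; ring

/-! ## 2. The door -/

/-- **THE EXACT-COVER DOOR (explicit size).** If some weighted brick list makes the layout matrix of the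
brick product nonsingular, the layout `(u, w)` has a nonsingular partition matrix at some `f` with
`deg f ≤ 2h` and `L(f) ≤ (2h+2)² · L(2h+4) + 2h + 1`. -/
theorem partitionMinor_hit_of_bricks {ι : Type*} [Fintype ι] [DecidableEq ι] (h : ℕ) {L : ℕ}
    (u w : ι → Finset (Fin h)) (ε : Fin L → ℂ) (Z W : Fin L → Finset (Fin h))
    (hdet : (Matrix.of fun i j : ι => MvPolynomial.coeff
      (∑ a ∈ u i, Finsupp.single (Fin.castAdd h a) 1 + ∑ c ∈ w j, Finsupp.single (Fin.natAdd h c) 1)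
      (∏ i : Fin L, (1 + C (ε i) * (∏ a ∈ Z i, X (Fin.castAdd h a)) *
        (∏ c ∈ W i, X (Fin.natAdd h c))) : MvPolynomial (Fin (h + h)) ℂ)).det ≠ 0) :
    ∃ f : MvPolynomial (Fin (h + h)) ℂ, f.totalDegree ≤ h + h ∧
      complexity f ≤ (h + h + 2) ^ 2 * (L * (2 * h + 4)) + (h + h + 1) ∧
      (Matrix.of fun i j : ι => MvPolynomial.coeff
        (∑ a ∈ u i, Finsupp.single (Fin.castAdd h a) 1 +
          ∑ c ∈ w j, Finsupp.single (Fin.natAdd h c) 1) f).det ≠ 0 := by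
  set F : MvPolynomial (Fin (h + h)) ℂ := ∏ i : Fin L, (1 + C (ε i) * (∏ a ∈ Z i, X (Fin.castAdd h a)) *
    (∏ c ∈ W i, X (Fin.natAdd h c))) with hF
  obtain ⟨hdeg, hcoeff, hsize⟩ := truncation_spec F (h + h)
  refine ⟨∑ e ∈ Finset.range (h + h + 1), homogeneousComponent e F, hdeg, ?_, ?_⟩
  · exact hsize.trans (by gcongr; exact complexity_brickProduct_le ε Z W)
  · have hmat : (Matrix.of fun i j : ι => MvPolynomial.coeff
        (∑ a ∈ u i, Finsupp.single (Fin.castAdd h a) 1 +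
          ∑ c ∈ w j, Finsupp.single (Fin.natAdd h c) 1)
        (∑ e ∈ Finset.range (h + h + 1), homogeneousComponent e F)) =
        Matrix.of fun i j : ι => MvPolynomial.coeff
          (∑ a ∈ u i, Finsupp.single (Fin.castAdd h a) 1 +
            ∑ c ∈ w j, Finsupp.single (Fin.natAdd h c) 1) F := by
      ext i j
      rw [Matrix.of_apply, Matrix.of_apply, hcoeff _ (degree_partitionExpo_le _ _)]
    rw [hmat]
    exact hdet

/-- **THE EXACT-COVER DOOR (class form).** For `h ≥ 2` and at most `(h+h)³` bricks the truncated brick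
product lies in `SmallCircuits ℂ (h+h) 8`. -/
theorem partitionMinor_hit_of_bricks_mem {ι : Type*} [Fintype ι] [DecidableEq ι] (h : ℕ) (hh : 2 ≤ h)
    {L : ℕ} (hL : L ≤ (h + h) ^ 3) (u w : ι → Finset (Fin h)) (ε : Fin L → ℂ)
    (Z W : Fin L → Finset (Fin h))
    (hdet : (Matrix.of fun i j : ι => MvPolynomial.coeff
      (∑ a ∈ u i, Finsupp.single (Fin.castAdd h a) 1 + ∑ c ∈ w j, Finsupp.single (Fin.natAdd h c) 1)
      (∏ i : Fin L, (1 + C (ε i) * (∏ a ∈ Z i, X (Fin.castAdd h a)) *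
        (∏ c ∈ W i, X (Fin.natAdd h c))) : MvPolynomial (Fin (h + h)) ℂ)).det ≠ 0) :
    ∃ f ∈ SmallCircuits ℂ (h + h) 8,
      (Matrix.of fun i j : ι => MvPolynomial.coeff
        (∑ a ∈ u i, Finsupp.single (Fin.castAdd h a) 1 +
          ∑ c ∈ w j, Finsupp.single (Fin.natAdd h c) 1) f).det ≠ 0 := by
  obtain ⟨f, hdeg, hsize, hf⟩ := partitionMinor_hit_of_bricks h u w ε Z W hdet
  refine ⟨f, ⟨hdeg, hsize.trans ?_⟩, hf⟩
  -- (2h+2)² · (2h)³ (2h+4) + 2h + 1 ≤ (2h)^8 for h ≥ 2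
  have e1 : (h + h + 2) ^ 2 ≤ 9 * (h * h) := by nlinarith
  have e2 : 2 * h + 4 ≤ 4 * h := by omega
  have e3 : (h + h + 2) ^ 2 * (L * (2 * h + 4)) + (h + h + 1) ≤
      9 * (h * h) * ((h + h) ^ 3 * (4 * h)) + 3 * h := by
    have : h + h + 1 ≤ 3 * h := by omega
    gcongr
  refine e3.trans ?_
  have e4 : 9 * (h * h) * ((h + h) ^ 3 * (4 * h)) + 3 * h = 288 * (h * h * h * h * h * h) + 3 * h := by
    ring
  have e5 : (h + h) ^ 8 = 256 * (h * h * h * h * h * h) * (h * h) := by ring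
  rw [e4, e5]
  have h4 : 4 ≤ h * h := by nlinarith
  have hX : h ≤ h * h * h * h * h * h := by
    calc h = h * 1 * 1 * 1 * 1 * 1 := by ring
      _ ≤ h * h * h * h * h * h := by gcongr <;> omega
  calc 288 * (h * h * h * h * h * h) + 3 * h ≤ 288 * (h * h * h * h * h * h) + 3 * (h * h * h * h * h * h) := by
        gcongr
    _ = 291 * (h * h * h * h * h * h) * 1 := by ring
    _ ≤ 256 * (h * h * h * h * h * h) * 4 := by nlinarith [Nat.zero_le (h * h * h * h * h * h)]
    _ ≤ 256 * (h * h * h * h * h * h) * (h * h) := Nat.mul_le_mul_left _ h4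

/-! ## 3. The links to item 19717 -/

/-- **The exact-cover door.** If for every `h ≥ 2` and every injective layout `(u, w)` SOME list of at most
`(h+h)³` weighted bricks makes the layout matrix of the brick product nonsingular, item 19717
`PartitionMinorsHitByVP` holds (`b = 8`, `h₀ = 2`). -/
theorem partitionMinorsHitByVP_of_bricks
    (hyp : ∀ h : ℕ, 2 ≤ h → ∀ (r : ℕ) (u w : Fin r → Finset (Fin h)),
      Function.Injective u → Function.Injective w →
      ∃ (L : ℕ) (_ : L ≤ (h + h) ^ 3) (ε : Fin L → ℂ) (Z W : Fin L → Finset (Fin h)),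
        (Matrix.of fun i j : Fin r => MvPolynomial.coeff
          (∑ a ∈ u i, Finsupp.single (Fin.castAdd h a) 1 +
            ∑ c ∈ w j, Finsupp.single (Fin.natAdd h c) 1)
          (∏ i : Fin L, (1 + C (ε i) * (∏ a ∈ Z i, X (Fin.castAdd h a)) *
            (∏ c ∈ W i, X (Fin.natAdd h c))) : MvPolynomial (Fin (h + h)) ℂ)).det ≠ 0) :
    Summit.ValiantsHypothesis.ValiantsHypothesis.Theses.BarrierLever.PartitionMinorsHitByVP := by
  refine ⟨8, 2, fun h hh r u w hu hw => ?_⟩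
  obtain ⟨L, hL, ε, Z, W, hdet⟩ := hyp h hh r u w hu hw
  exact partitionMinor_hit_of_bricks_mem h hh hL u w ε Z W hdet

/-- **The exact-cover door on simplicial complexes.** By the lower-set reduction
(`DownCompression.partitionMinorsHitByVP_of_lowerSets`) brick certificates are needed only for injective
layouts whose row family AND column family have lower-set ranges (`b = 12`). -/
theorem partitionMinorsHitByVP_of_bricks_lowerSets
    (hyp : ∀ h : ℕ, 2 ≤ h → ∀ (r : ℕ) (u w : Fin r → Finset (Fin h)),
      Function.Injective u → Function.Injective w →
      IsLowerSet (Set.range u) → IsLowerSet (Set.range w) →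
      ∃ (L : ℕ) (_ : L ≤ (h + h) ^ 3) (ε : Fin L → ℂ) (Z W : Fin L → Finset (Fin h)),
        (Matrix.of fun i j : Fin r => MvPolynomial.coeff
          (∑ a ∈ u i, Finsupp.single (Fin.castAdd h a) 1 +
            ∑ c ∈ w j, Finsupp.single (Fin.natAdd h c) 1)
          (∏ i : Fin L, (1 + C (ε i) * (∏ a ∈ Z i, X (Fin.castAdd h a)) *
            (∏ c ∈ W i, X (Fin.natAdd h c))) : MvPolynomial (Fin (h + h)) ℂ)).det ≠ 0) :
    Summit.ValiantsHypothesis.ValiantsHypothesis.Theses.BarrierLever.PartitionMinorsHitByVP := by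
  refine DownCompression.partitionMinorsHitByVP_of_lowerSets ⟨8, 2, fun h hh r u w hu hw hlu hlw => ?_⟩
  obtain ⟨L, hL, ε, Z, W, hdet⟩ := hyp h hh r u w hu hw hlu hlw
  exact partitionMinor_hit_of_bricks_mem h hh hL u w ε Z W hdet

end

end Summit.ValiantsHypothesis.ValiantsHypothesis.Theorems.BarrierLever.ExactCoverDoor
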